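import Summits.BirchSwinnertonDyer.BirchSwinnertonDyer.Theorems.KolyvaginDepthDoorDepthTableRowKitSecondSign
import Summits.BirchSwinnertonDyer.BirchSwinnertonDyer.Theorems.KolyvaginDepthDoorDepthTableGlobalMinimal
import Summits.BirchSwinnertonDyer.BirchSwinnertonDyer.Theorems.KolyvaginDepthDoorDepthTableOddPrimeKit
import Summits.BirchSwinnertonDyer.BirchSwinnertonDyer.Theorems.Rank2ObservatoryKernelPrimes
import Summits.BirchSwinnertonDyer.BirchSwinnertonDyer.Theorems.Rank1ResidualIntModelReduction
import Summits.BirchSwinnertonDyer.Rank1Residual.Additive.PointCountEulerNat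
import Literature.NumberTheory.EllipticCurves.ComplexMultiplicationNotSemistable
import Literature.NumberTheory.EllipticCurves.RationalPointInfiniteOrderCriteria
import Mathlib.Tactic.NormNum.LegendreSymbol
import HarnessLib

/-!
# Route `KolyvaginDepthDoor` — DEPTH-TABLE ROWS ON THE SECOND SIGN, part 8: `89a1` `(5, -91, 239)`
# (crux `KolyvaginDepthSupply`, stmt-BirchSwinnertonDyer-21765)

Helper file (`--supports stmt-BirchSwinnertonDyer-21765 --as helper`); it closes nothing and BSD is
not proved by it. Same design as part 1 (`…DepthTableRowsSecondSign1`, which see for the full account):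
a RANK-ONE curve `E`, a Heegner field `K = ℚ(√D)` for `N_E` whose twist `E^{(D)}` has two independent
rational points certified IN THE KERNEL (`Rank2Observatory.two_le_mordellWeilRank_of_ratCert` on the
twist model `[0, D b₂, 0, 8D²b₄, 16D³b₆]` of the kit `…RowKitSecondSign`), every other side condition
(global minimality, non-CM, `ρ̄_{E,p^m}` onto ∀ `m`, `p` good ordinary, Heegner condition, Kolyvagin prime,
`1 ≤ rank_ℤ E(ℚ)`) a kernel theorem; each row `SecondSign.C<label>.depthRow_<p>_neg<|D|>_<ℓ>_secondSign`
concludes from the bit `c_1(ℓ) ≠ 0` at ANY datum, granted (γ) = `GrossLMS1991.prop37_2_frobeniusCongruence`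
only: `corank Ш(E)[p^∞] = 0`, `rank E = 1`, `corank Ш(E^{(D)})[p^∞] = 0`, `rank E^{(D)} = 2`,
`E(ℚ)[p] = 0`, `Ш(E)[p] = 0`, `#Sel_p(E) = p`, `Ш(E^{(D)})[p] = 0`, `#Sel_p(E^{(D)}) = p²`. CONDITIONAL on
(γ) and the bit; per-curve; BSD is not proved by it.

| curve | `Δ` | `p` (`a_p`) | `d_K` | `ℓ` (`a_ℓ`) | twist model | `P₁`, `P₂` on the twist model |
|---|---|---|---|---|---|---|
| `89a1` = `[1,1,1,-1,0]` | `-89` | `5` (`-1`) | `-91` | `239` (`5`) | `[0,-455,0,-66248,-12057136]` | `(1820, -66248)`, `(2022748/9, -2873904488/27)` |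

References: [Kolyvagin1991MathAnn] Thm. 2.3; [GrossLMS1991] Prop. 3.7 (2), §5 (5.1), Prop. 6.2 (1);
[McCallumLMS1991] §§2–5; [Serre1972] §5.4 Prop. 21; [Mazur1978] §6 Prop. 6.3 (1); [CremonaAlgorithms1997]
Table 1, §2.4, §3.5; [SilvermanAEC2009] III.2.3, VII.3.1(b), VII.3.4, VIII.6.7, X.5 Cor. 5.4;
[Marcus1977] Ch. 3 Thm. 25; [JetchevLauterStein2009] §3.6 (arXiv:0707.0032).
-/

set_option linter.dupNamespace false

noncomputable section

open scoped Classical NumberField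

namespace Summit.BirchSwinnertonDyer.BirchSwinnertonDyer.Theorems.KolyvaginDepthDoor

open Literature.NumberTheory.EllipticCurves Literature.NumberTheory.EllipticCurves.ModularForms
  WeierstrassCurve
open Summit.BirchSwinnertonDyer.BirchSwinnertonDyer.Rank2Observatory
open Summit.BirchSwinnertonDyer.BirchSwinnertonDyer.Rank1Residual
open Summit.BirchSwinnertonDyer.Rank1Residual.Additive

namespace SecondSign

/-! ## Curve `89a1` = `[1,1,1,-1,0]` (`Δ = -89`), rank one -/

namespace C89a1

/-- `89a1` = `[1,1,1,-1,0]` is an elliptic curve over `ℚ` (`Δ = -89 ≠ 0`, kernel-checked).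
[cite: CremonaAlgorithms1997, Table 1 (89a1)] -/
theorem isElliptic : ((⟨1, 1, 1, -1, 0⟩ : WeierstrassCurve ℤ).map (Int.castRingHom ℚ)).IsElliptic := by
  rw [WeierstrassCurve.isElliptic_iff, WeierstrassCurve.map_Δ, isUnit_iff_ne_zero, eq_intCast,
    Int.cast_ne_zero]
  decide +kernel

/-- **`89a1` = `[1,1,1,-1,0]` is a global minimal equation over `ℚ`** (`|Δ| = 89 < 3¹²`, `2¹² ∤ Δ`;
`isGloballyMinimal_map_int_of_natAbs_Δ_lt`, kernel-checked). [cite: CremonaAlgorithms1997, Table 1 (89a1)]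
[cite: SilvermanAEC2009, VII.1 Remark 1.1 and VIII.8] -/
theorem isGloballyMinimal : ((⟨1, 1, 1, -1, 0⟩ : WeierstrassCurve ℤ).map (Int.castRingHom ℚ)).IsGloballyMinimal :=
  isGloballyMinimal_map_int_of_natAbs_Δ_lt _ (by decide +kernel) (by decide +kernel) (by decide +kernel)

/-- The integral model of `89a1` is `[1,1,1,-1,0]`. [cite: CremonaAlgorithms1997, Table 1 (89a1)] -/
theorem intModel :
    haveI := isGloballyMinimal;
    integralModelInt ((⟨1, 1, 1, -1, 0⟩ : WeierstrassCurve ℤ).map (Int.castRingHom ℚ)) = ⟨1, 1, 1, -1, 0⟩ := by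
  haveI := isGloballyMinimal
  exact IntModel.integralModelInt_eq_of_map_eq _ rfl

/-- `#Ẽ(𝔽_5) = 7`, `a_5 = -1` for `89a1`, kernel-decided (`ℕ`-arithmetic Euler count
`PointCountNat.natCard_point_map_eq`). [cite: CremonaAlgorithms1997, Table 1 (89a1) and §2.4] -/
theorem card_5 :
    Nat.card (((⟨1, 1, 1, -1, 0⟩ : WeierstrassCurve ℤ).map (Int.castRingHom (ZMod 5))).toAffine.Point) = 7 := by
  rw [PointCountNat.natCard_point_map_eq (hℓ := ⟨by norm_num⟩) (by norm_num) 1 1 1 (-1) 0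
    (by decide +kernel)]
  decide +kernel

/-- `#Ẽ(𝔽_7) = 12`, `a_7 = -4` for `89a1`, kernel-decided (`ℕ`-arithmetic Euler count
`PointCountNat.natCard_point_map_eq`). [cite: CremonaAlgorithms1997, Table 1 (89a1) and §2.4] -/
theorem card_7 :
    Nat.card (((⟨1, 1, 1, -1, 0⟩ : WeierstrassCurve ℤ).map (Int.castRingHom (ZMod 7))).toAffine.Point) = 12 := by
  rw [PointCountNat.natCard_point_map_eq (hℓ := ⟨by norm_num⟩) (by norm_num) 1 1 1 (-1) 0
    (by decide +kernel)]
  decide +kernel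

/-- `#Ẽ(𝔽_239) = 235`, `a_239 = 5` for `89a1`, kernel-decided (`ℕ`-arithmetic Euler count
`PointCountNat.natCard_point_map_eq`). [cite: CremonaAlgorithms1997, Table 1 (89a1) and §2.4] -/
theorem card_239 :
    Nat.card (((⟨1, 1, 1, -1, 0⟩ : WeierstrassCurve ℤ).map (Int.castRingHom (ZMod 239))).toAffine.Point) = 235 := by
  rw [PointCountNat.natCard_point_map_eq (hℓ := ⟨by norm_num⟩) (by norm_num) 1 1 1 (-1) 0
    (by decide +kernel)]
  decide +kernel

/-- **`5 ∈ B(89a1)`: `ρ̄_{E,5^m}` is onto for every `m`** (unconditional): semistable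
(`gcd(c₄, Δ) = 1`), `X² − a_7 X + 7` with `a_7 = -4` root-free mod `5` (`E[5]` irreducible, Mazur
6.3; onto, Serre Prop. 21), and the multiplicative prime `89` with `89^1 ∥ Δ`, `5 ∤ 1` (a transvection
lifts the image to `GL₂(ℤ/5^m)`; `hasSurjectiveModNGaloisRep_pow_of_intModel_certificate`).
[cite: Serre1972, §5.4 Prop. 21] [cite: Mazur1978, §6 Prop. 6.3 (1)] [cite: SerreAbelianLadic1968, Ch. IV §3.4] -/
theorem hasSurjectiveModNGaloisRep_pow_5 (m : ℕ) :
    ((⟨1, 1, 1, -1, 0⟩ : WeierstrassCurve ℤ).map (Int.castRingHom ℚ)).HasSurjectiveModNGaloisRep (5 ^ m : ℕ) := by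
  have hn : ∀ t : ZMod 5, t ^ 2 - (((7 : ℕ) : ℤ) + 1 - (12 : ℕ) : ℤ) * t + ((7 : ℕ) : ZMod 5) ≠ 0 := by
    decide +kernel
  haveI := Fact.mk (by norm_num : Nat.Prime 5)
  haveI := Fact.mk (by norm_num : Nat.Prime 7)
  haveI := isElliptic
  haveI := isGloballyMinimal
  exact hasSurjectiveModNGaloisRep_pow_of_intModel_certificate intModel
    (by rw [Int.isCoprime_iff_gcd_eq_one]; decide +kernel) 5 7 (by norm_num) (by decide +kernel)
    (n := 12) card_7 hn 89 (by norm_num) (by norm_num) (by decide +kernel) (by decide +kernel)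
    (e := 1) (by decide +kernel) (by decide +kernel) (by decide +kernel) m

/-- **`5` is a prime of good ordinary reduction for `89a1`** (`5 ∤ Δ`, `a_5 = -1`) — the crux's
conditions on the witness prime. [cite: CremonaAlgorithms1997, Table 1 (89a1)] -/
theorem goodOrdinary_5 :
    haveI := Fact.mk (by norm_num : Nat.Prime 5);
    haveI := isGloballyMinimal;
    ((⟨1, 1, 1, -1, 0⟩ : WeierstrassCurve ℤ).map (Int.castRingHom ℚ)).HasGoodReductionAtPrime 5 ∧ ¬ ((5 : ℕ) : ℤ) ∣ ((⟨1, 1, 1, -1, 0⟩ : WeierstrassCurve ℤ).map (Int.castRingHom ℚ)).frobeniusTrace 5 := by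
  haveI := Fact.mk (by norm_num : Nat.Prime 5)
  haveI := isGloballyMinimal
  exact goodOrdinary_of_intModel_certificate intModel 5 (by decide +kernel) (n := 7) card_5
    (by decide +kernel)

/-- **`89a1` is not CM** (unconditional): multiplicative reduction at `89` (`89 ∣ Δ = -89`,
`89 ∤ c₄ = 49`), while a CM curve over `ℚ` has no multiplicative prime (integral `j`).
[cite: SilvermanATAEC1994, Thm. II.6.4 (PDF p. 148)] [cite: CremonaAlgorithms1997, Table 1 (89a1)] -/
theorem not_hasCM :
    haveI := isElliptic;
    ¬ ((⟨1, 1, 1, -1, 0⟩ : WeierstrassCurve ℤ).map (Int.castRingHom ℚ)).HasCM := by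
  haveI := isElliptic
  haveI := isGloballyMinimal
  haveI := Fact.mk (by norm_num : Nat.Prime 89)
  intro hCM
  exact not_hasMultiplicativeReductionAtPrime_of_hasCM _ hCM 89
    (IntModel.hasMultiplicativeReductionAtPrime_of_intModel intModel 89 (by decide +kernel)
      (by decide +kernel))

/-- **`1 ≤ rank_ℤ E(ℚ)` for `89a1` IN THE KERNEL** — kind-`NL` certificate: the rational point
`3·(-1, 1) = (15/49, -55/343)` has `7 ∣ den(x)`, hence infinite order (AEC VII.3.4; tree
`one_le_mordellWeilRank_of_dvd_den`). [cite: SilvermanAEC2009, VII.3.4 and Thm. VIII.6.7]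
[cite: CremonaAlgorithms1997, Table 1 (89a1)] -/
theorem one_le_rank : 1 ≤ ((⟨1, 1, 1, -1, 0⟩ : WeierstrassCurve ℤ).map (Int.castRingHom ℚ)).mordellWeilRank := by
  haveI := isElliptic
  haveI := isGloballyMinimal
  haveI : Fact (Nat.Prime 7) := ⟨by norm_num⟩
  have hP : ((⟨1, 1, 1, -1, 0⟩ : WeierstrassCurve ℤ).map (Int.castRingHom ℚ)).toAffine.Nonsingular ((15 : ℚ) / 49) ((-55 : ℚ) / 343) :=
    WeierstrassCurve.Affine.equation_iff_nonsingular.mp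
      ((WeierstrassCurve.Affine.equation_iff _ _).mpr (by norm_num [WeierstrassCurve.map]))
  exact one_le_mordellWeilRank_of_dvd_den _ 7 (by norm_num) hP (by decide +kernel)


/-! ### Row `89a1`, `(p, d_K, ℓ) = (5, -91, 239)`: the twist `E^{(-91)}` has rank two -/

/-- **Heegner data `d_K = -91` for `89a1`**: every prime of `Δ = -89` (hence of `N_E`) splits in a
quadratic field of discriminant `-91` (Kronecker symbols `= 1`). [cite: Marcus1977, Ch. 3 Thm. 25]
[cite: GrossLMS1991, §1] -/
theorem heegner_neg91 : ∀ q : ℕ, q.Prime → (q : ℤ) ∣ (⟨1, 1, 1, -1, 0⟩ : WeierstrassCurve ℤ).Δ →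
    (q = 2 → (-91 : ℤ) % 8 = 1) ∧ (q ≠ 2 → jacobiSym (-91) q = 1) :=
  forall_prime_dvd_of_natAbs_eq_pow (a := 89) (i := 1) (by decide +kernel) (by norm_num)
    ⟨by norm_num, by norm_num⟩

/-- The twist model of the kit `…RowKitSecondSign` for `(89a1, D = -91)`:
`[0, D b₂, 0, 8 D² b₄, 16 D³ b₆] = ⟨0, -455, 0, -66248, -12057136⟩` (`ℚ`-isomorphic to `E^{(-91)}`, `u = 1/2`).
[cite: SilvermanAEC2009, X.5 Cor. 5.4] -/
theorem twistModel_neg91 :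
    (⟨0, (-91) * (⟨1, 1, 1, -1, 0⟩ : WeierstrassCurve ℤ).b₂, 0, 8 * (-91) ^ 2 * (⟨1, 1, 1, -1, 0⟩ : WeierstrassCurve ℤ).b₄, 16 * (-91) ^ 3 * (⟨1, 1, 1, -1, 0⟩ : WeierstrassCurve ℤ).b₆⟩ : WeierstrassCurve ℤ) =
      ⟨0, -455, 0, -66248, -12057136⟩ := by
  ext <;> decide +kernel

/-- Killers for the twist model `⟨0, -455, 0, -66248, -12057136⟩` of `E^{(-91)}` from the kernel counts
`(q, #Ṽ(𝔽_q)) ∈ [(3, 3), (5, 7)]`. [cite: SilvermanAEC2009, Prop. VII.3.1(b)] -/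
theorem killers_neg91 : ∀ ℓN ∈ [((3 : ℕ), (3 : ℕ)), (5, 7)], ℓN.1.Prime ∧
    ∀ (x : ((⟨0, -455, 0, -66248, -12057136⟩ : WeierstrassCurve ℤ).map (Int.castRingHom ℚ)).toAffine.Point)
      (n : ℕ), ¬ ℓN.1 ∣ n → n • x = 0 → ℓN.2 • x = 0 :=
  killers_cons _ (q := 3) (N := 3) (by decide +kernel) (by decide +kernel)
    (killers_cons _ (q := 5) (N := 7) (by decide +kernel) (by decide +kernel)
    (killers_nil _))

/-- **`2 ≤ rank_ℤ E^{(-91)}(ℚ)` for `E = 89a1` IN THE KERNEL**, on the twist model `⟨0, -455, 0, -66248, -12057136⟩`: rational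
kernel certificate `Rank2Observatory.two_le_mordellWeilRank_of_ratCert` with the points
`P₁ = (1820, -66248)`, `P₂ = (2022748/9, -2873904488/27)` (found by a naive search on `d·η² = f(x)`), their chord
`P₁ + P₂ = (6293/4, -411943/8)`, odd torsion annihilator `t = 1` from the counts at `q = 3, 5`, and doubling
witnesses at `q = 11, 37, 11` (residues `(5,5)`, `(20,1)`, `(3,5)`). Hence `P₁, P₂` are
`ℤ`-independent. [cite: SilvermanAEC2009, III.2.3, Prop. VII.3.1(b) and Thm. VIII.6.7]
[cite: CremonaAlgorithms1997, §3.5] -/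
theorem two_le_rank_twist_neg91 :
    2 ≤ ((⟨0, -455, 0, -66248, -12057136⟩ : WeierstrassCurve ℤ).map (Int.castRingHom ℚ)).mordellWeilRank :=
  two_le_mordellWeilRank_of_ratCert _ (x₁ := 1820) (y₁ := -66248) (x₂ := 2022748/9) (y₂ := -2873904488/27)
    (x₃ := 6293/4) (y₃ := -411943/8) (by decide +kernel) (by decide +kernel)
    (by decide +kernel) (by decide +kernel) (t := 1) (by decide) killers_neg91 (by decide +kernel)
    11 37 11 (by decide +kernel) (by decide +kernel) (by decide +kernel) (by decide +kernel)
    (by decide +kernel) (by decide +kernel) 5 5 20 1 3 5 (by decide +kernel)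
    (by decide +kernel) (by decide +kernel) (by decide +kernel) (by decide +kernel)
    (by decide +kernel)

/-- **SECOND-SIGN DEPTH-TABLE ROW `89a1`, `(p, d_K, ℓ) = (5, -91, 239)`, ON PRINT-STANDARD INPUTS.**
For `E = 89a1` (rank one), ANY imaginary quadratic `K` with `d_K = -91` (Heegner for `N_E`; the twist
`E^{(-91)}` has two independent rational points, certified in the kernel), any frame `(Dt, β, ι)` and
ANY single Kolyvagin–Heegner datum `d` of conductor `239` (a Kolyvagin prime: `(-91/239) = −1`,
`5 ∣ 239 + 1`, `5 ∣ a_239 = 5`), granted the ONE Literature fact (γ) =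
`GrossLMS1991.prop37_2_frobeniusCongruence` (Gross 1991 Prop. 3.7 (2); cite-only): IF
`d.kolyvaginClass _ 1 ≠ 0` (the row's bit), THEN `corank_{ℤ_5} Ш(E)[5^∞] = 0`, `rank_ℤ E(ℚ) = 1`,
`corank_{ℤ_5} Ш(E^{(-91)})[5^∞] = 0`, `rank_ℤ E^{(-91)}(ℚ) = 2`, `E(ℚ)[5] = 0`, `Ш(E/ℚ)[5] = 0`,
`#Sel^(5)(E/ℚ) = 5`, `Ш(E^{(-91)}/ℚ)[5] = 0` and `#Sel^(5)(E^{(-91)}/ℚ) = 5²` — the crux's SECOND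
rank clause `ν = rank E(ℚ) = rank E^{(d_K)}(ℚ) − 1` at this curve, and `Ш[5] = 0` for the RANK-TWO
curve `E^{(-91)}` (conductor `N_E·91²`), which no first-sign row reaches through `K`. Side conditions:
`ρ̄_{E,5^m}` onto (`hasSurjectiveModNGaloisRep_pow_5`), non-CM, Heegner, Kolyvagin prime
(`card_239`), (KN_5) from `Δ(E₀) = -89` (`decide`-able table), `1 ≤ rank` (`one_le_rank`),
`2 ≤ rank E^{(-91)}` (`two_le_rank_twist_neg91`) — all kernel theorems. CONDITIONAL on (γ) and the
bit; per-curve; BSD is not proved by it. [cite: Kolyvagin1991MathAnn, Thm. 2.3]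
[cite: GrossLMS1991, Prop. 3.7 (2), §5 (5.1), Prop. 6.2 (1)] [cite: McCallumLMS1991, §§2–5]
[cite: JetchevLauterStein2009, §3.6 (arXiv:0707.0032)] -/
theorem depthRow_5_neg91_239_secondSign
    (h372 : GrossLMS1991.prop37_2_frobeniusCongruence)
    (K : Type) [Field K] [NumberField K] (hK : IsImaginaryQuadratic K)
    (hD : NumberField.discr K = -91) :
    haveI := isElliptic;
    haveI := isGloballyMinimal;
    haveI : NeZero (((⟨1, 1, 1, -1, 0⟩ : WeierstrassCurve ℤ).map (Int.castRingHom ℚ)).conductorNorm ℤ) := neZero_conductorNorm_of_isElliptic _;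
    ∀ (Dt : ModularParametrizationData ((⟨1, 1, 1, -1, 0⟩ : WeierstrassCurve ℤ).map (Int.castRingHom ℚ)) (((⟨1, 1, 1, -1, 0⟩ : WeierstrassCurve ℤ).map (Int.castRingHom ℚ)).conductorNorm ℤ)) (β : ℤ) (ι : K →+* ℂ)
      (d : KolyvaginHeegnerData Dt β ι 239),
    d.kolyvaginClass (p := 5) (by norm_num) 1 ≠ 0 →
    ((⟨1, 1, 1, -1, 0⟩ : WeierstrassCurve ℤ).map (Int.castRingHom ℚ)).shaCorank 5 = 0 ∧ ((⟨1, 1, 1, -1, 0⟩ : WeierstrassCurve ℤ).map (Int.castRingHom ℚ)).mordellWeilRank = 1 ∧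
      (((⟨1, 1, 1, -1, 0⟩ : WeierstrassCurve ℤ).map (Int.castRingHom ℚ)).quadraticTwist ((-91 : ℤ) : ℚ)).shaCorank 5 = 0 ∧
      (((⟨1, 1, 1, -1, 0⟩ : WeierstrassCurve ℤ).map (Int.castRingHom ℚ)).quadraticTwist ((-91 : ℤ) : ℚ)).mordellWeilRank = 2 ∧
      (∀ P : ((⟨1, 1, 1, -1, 0⟩ : WeierstrassCurve ℤ).map (Int.castRingHom ℚ)).toAffine.Point, 5 • P = 0 → P = 0) ∧
      (∀ x ∈ ((⟨1, 1, 1, -1, 0⟩ : WeierstrassCurve ℤ).map (Int.castRingHom ℚ)).sha, 5 • x = 0 → x = 0) ∧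
      Nat.card ↥(selmerGroup ((⟨1, 1, 1, -1, 0⟩ : WeierstrassCurve ℤ).map (Int.castRingHom ℚ)) ((5 : ℕ) : ℤ)) = 5 ∧
      (∀ x ∈ (((⟨1, 1, 1, -1, 0⟩ : WeierstrassCurve ℤ).map (Int.castRingHom ℚ)).quadraticTwist ((-91 : ℤ) : ℚ)).sha, 5 • x = 0 → x = 0) ∧
      Nat.card ↥(selmerGroup (((⟨1, 1, 1, -1, 0⟩ : WeierstrassCurve ℤ).map (Int.castRingHom ℚ)).quadraticTwist ((-91 : ℤ) : ℚ)) ((5 : ℕ) : ℤ)) = 5 ^ 2 := by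
  haveI := isElliptic
  haveI := isGloballyMinimal
  haveI : NeZero (((⟨1, 1, 1, -1, 0⟩ : WeierstrassCurve ℤ).map (Int.castRingHom ℚ)).conductorNorm ℤ) := neZero_conductorNorm_of_isElliptic _
  intro Dt β ι d hne
  haveI := Fact.mk (by norm_num : Nat.Prime 5)
  exact depthRowSecondSign_print_of_datum_of_intModel_certificate intModel h372 not_hasCM one_le_rank
    5 (by norm_num) hasSurjectiveModNGaloisRep_pow_5 K hK hD (by norm_num) (by norm_num)
    twistModel_neg91 two_le_rank_twist_neg91 heegner_neg91 239 (by norm_num) (by norm_num)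
    (by decide +kernel) (by norm_num) (by norm_num) (by norm_num) (by norm_num) (n := 235) card_239
    (by norm_num) (Δ₀ := -89) (by decide +kernel) (B := 11) (by decide +kernel) (by decide +kernel)
    (fun _ _ ↦ Or.inl (by norm_num)) Dt β ι d hne

end C89a1


end SecondSign

end Summit.BirchSwinnertonDyer.BirchSwinnertonDyer.Theorems.KolyvaginDepthDoor

end
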